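/-
Copyright (c) 2026 the pub-hodgecm-mathlib formalisation cell (harness21).  Prover seat hodgecm-mathlib-B-p14 (g43): «NORM-ONE TORUS LADDER for `K(√d)∕K` WILD, define-free»
(F0P3a-p06 (g18) seam deal (w2′) 10:39:06Z BY NAME; LH4 wild base-layer seam; census F0P3a-p06 (g17) `DUNR-H2-CENSUS.md` §1 M4∕M6: the wild type-(2) tori
`T = Res¹ L_w(√d)^×`); 2026-09-02.
-/
import Literature.NumberTheory.LocalFields.WildQuadraticNormLadderAPI   -- ★ B-p14 (g43): the norm ladder + `le_exp_neg_add_one_of_lt_exp_neg`; brings the whole wild quadratic layer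
import HarnessLib

/-!
# Wild quadratic norms — the NORM-ONE TORUS `T_d = {a + b√d : a² − d b² = 1}` of `K(√d)∕K`, define-free: Hilbert 90, the depth of a quotient `z∕σz`,
# no-tie, unit quotients are deep (`v(4dβ²) ≤ exp(−f)`), uniformisers read `exp(−f)` exactly, and no odd steps

Topic `NumberTheory/LocalFields`; namespace `Literature.NumberTheory.LocalFields`.  THEOREMS ONLY (no definition, no instance, no notation, no named fact, no `sorry`);
CM-free; kernel lane `--supports stmt-HodgeConjecture-24833`.  Cell `pub/hodgecm-mathlib` (D-0151), crux H413 = `stmt-HodgeConjecture-24833`; half A line LH4, DYADIC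
pay-down leaf `Cruxes/H413/Lines/F0_P3c_DyadicPaydown.lean`, organs (D-UNR)∕(D-RAM) (PRINT by D74′; census F0P3a-p06 (g17) OUTCOME B: the self-dual lattice laws (M4) and
the Euler–Poincaré relation (M6) live on the wild type-(2) tori `T = Res¹ K₂^×`, `K₂ = L_w(√disc γ)` — a quadratic extension of the LOCAL field `L_w` which is NOT the
completion of a CM extension, so the CM-place files do not cover it).  Twelfth file of the wild quadratic layer; the DEFINE-FREE TWIN of ★ p851075
`Automorphic/RamifiedPlaceNormOneTorus` (LH4-p02 (g5): the norm-one torus of `L_w ∕ L⁺_v` in `σ_w`-currency — Hilbert 90, `|z∕σz − 1| = |σz − z|∕|z|`, the dichotomy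
`T = T^{(d)} ⊔ (τ∕στ)·T^{(d)}`, no odd steps) and companion of ★ MARS-to-be `Automorphic/RamifiedPlaceOrderUnitIndex` (LH4-p01 (g4), the conductor-`j` unit index);
here no extension field, no `σ`: an element `z = α + β√d` of `E = K(√d)` is the PAIR `(α, β)`, `σ z = (α, −β)`, `N z = α² − dβ²`, and for `E ∕ K` totally ramified
`v_E = v_K ∘ N`.  HONEST LABEL: HC_CM is proved only modulo the 7 printed citations (2 remaining named inputs: hLiu418 = stmt-HodgeConjecture-24832, h413 =
stmt-HodgeConjecture-24833) until rung 0 closes; count-neutral, Mathlib-footed, bankable base layer.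

CURRENCY (= ★ `WildQuadraticNormLadder`).  `T_d` := the pairs `(a, b)` with `a·a − d·(b·b) = 1`; DEPTH of `(a, b)` := `Valued.v ((a − 1)·(a − 1) − d·(b·b))` (= `v_E(t − 1)`);
the QUOTIENT `z∕σz` of `z = (α, β)` with `N = α² − dβ² ≠ 0` is the pair `((α² + dβ²)∕N, 2αβ∕N)`; a define-free UNIT of `E` is a pair with `v(α² − dβ²) = 1`, a define-free
UNIFORMISER of `E` a pair with `v(α² − dβ²) = exp(−1)`; conductor `f = t + 1` as in ★ p851058 (`f = 2e + 1` odd order, `f = 2e + 1 − s` odd defect `s`).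

* §1 ALGEBRA (any field): `sq_sub_mul_sq_sub_one_eq_of_norm_one` — ON `T_d` THE DEPTH COLLAPSES: `(a − 1)² − d b² = 2(1 − a)`; `norm_quotient_eq_one` — the quotient lands in
  `T_d` (`(α² + dβ²)² − d(2αβ)² = (α² − dβ²)²`); `exists_quotient_of_norm_one` — **HILBERT 90, define-free**: `2 ≠ 0`, `d ≠ 0`, `a² − d b² = 1` ⇒ `(a, b)` is the quotient of
  `z = (1 + a, b)` (`N z = 2(1 + a)`), or of `z = (0, 1) = √d` when `a = −1`; `depth_quotient_eq` — **`(a−1)² − d b² = −4dβ²∕N`** for the quotient of `(α, β)`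
  (★ p851075's `|z∕σz − 1| = |σz − z|∕|z|`: `σz − z = −2β√d`, `N(2β√d) = −4dβ²`); `quotient_mul_eq` — `K^×`-rescaling `(cα, cβ)` gives the same quotient.
* §2 NO-TIE (valuation of a norm is a max; sharp form of ★ p851058 §2): `valued_sq_sub_mul_sq_eq_max_of_odd` — `v d` not a square value ⇒ `v(α² − dβ²) = max(v α², v d·v β²)`;
  `valued_sq_sub_mul_sq_eq_max_of_odd_defect` — `v 4 < v(d − 1)` not a square value ⇒ `v(α² − dβ²) = max(v((α − β)(α + β)), v(d − 1)·v β²)` AND the first argument is a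
  square value or strictly below the second (trichotomy of `v(2β)` against `v(α − β)`).
* §3 READ-OFFS (`v 2 = exp(−e)`): `valued_four_mul_mul_sq_le_of_unit_odd` ∕ `…_of_unit_odd_defect` — for a define-free UNIT, `v(4dβ²) ≤ exp(−f)`;
  `valued_four_mul_mul_sq_eq_of_odd_value_odd` ∕ `…_odd_defect` — if `v(α² − dβ²) = exp(−(2m + 1))` (odd value, e.g. a UNIFORMISER, `m = 0`) then `v(4dβ²) = exp(−(f + 2m))`
  EXACTLY; PARITY `valued_four_mul_mul_sq_ne_sq_of_odd` (odd order: `v(4dβ²)` is never a square value, `β ≠ 0`) ∕ `valued_four_mul_mul_sq_eq_sq_of_odd_defect` (odd defect: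
  it always is) — NO ODD STEPS: quotient depths of units all have the parity of `f`; `exists_uniformizer_pair_odd` ∕ `…_odd_defect` — define-free uniformisers exist
  (`(0, ϖ^{−r})` for `v d = exp(−(2r + 1))`; `(−ϖ^{−k}, ϖ^{−k})` for defect `s = 2k + 1`).
SEQUEL (`WildQuadraticNormOneTorusAPI`): the TORUS READINGS (unit quotients lie in `T^{(f)}`; the uniformiser quotient has depth EXACTLY `exp(−(f − 1))` — the break
`t = f − 1`), the DICHOTOMY `T = T^{(f)} ⊔ (π_E∕σπ_E)·T^{(f)}` with `T^{(f)}` = unit quotients (rescaling normal form), exclusivity, and `T^{(f+2j)}` ⊇ quotients of the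
conductor-`j` order (twin of ★ p851075 (N4)(N5), of ★ MARS-to-be).
NOT HERE (honest scope): the unramified class (`f = 0`); indices as numbers (`[T^{(f)} : T^{(f+2j)}] = q^j` is MARS' theorem — LH4-p01 (g4) in CM currency; the define-free
count needs the `Finset`∕`Nat.card` dress of the pair filtration, not attempted).

## References
* [Serre1979] J.-P. Serre, *Local Fields*, GTM 67 (1979): Ch. V §3 (the filtration of the units and of the norm-one elements in a cyclic totally ramified extension;
  `i_G(σ) = t + 1 = f`), Ch. X §1 (Hilbert 90, cyclic case `H¹ = 0`: `N t = 1 ⇒ t = z∕σz`), Ch. IV §1–§2.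
* [Flicker1998UnitaryFL] Y. Z. Flicker, *Elementary proof of the fundamental lemma for a unitary group*, Canad. J. Math. 50 (1998), Prop. 7 p. 84 (the norm-one filtration
  `[R_L¹ : R_L(j)¹] = q^j`, tame), §6 p. 95 REMARK (Mars' index).
* [Omeara1963] O. T. O'Meara, *Introduction to Quadratic Forms*, Grundlehren 117 (1963), §63A 63:2–63:5 (normal forms of dyadic square classes).
-/

set_option autoImplicit false

noncomputable section

open scoped Valued WithZero
open WithZero

namespace Literature.NumberTheory.LocalFields

/-! ## §1 Algebra of the norm-one torus (any field) -/
section Algebra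
variable {K : Type*} [Field K]

/-- **ON `T_d` THE DEPTH COLLAPSES**: if `a·a − d·(b·b) = 1` then `(a − 1)·(a − 1) − d·(b·b) = 2·(1 − a)` — `N(t − 1) = 2 − Tr t` for `N t = 1`.
[cite: Serre1979, Ch. V §3] -/
theorem sq_sub_mul_sq_sub_one_eq_of_norm_one {d a b : K} (h : a * a - d * (b * b) = 1) :
    (a - 1) * (a - 1) - d * (b * b) = 2 * (1 - a) := by
  linear_combination h

/-- **THE QUOTIENT `z∕σz` LANDS IN `T_d`**: for `N = α² − dβ² ≠ 0`, the pair `((α² + dβ²)∕N, 2αβ∕N)` has norm `1` (`(α² + dβ²)² − d(2αβ)² = (α² − dβ²)²`).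
[cite: Serre1979, Ch. X §1] -/
theorem norm_quotient_eq_one (d : K) {α β : K} (hN : α * α - d * (β * β) ≠ 0) :
    (α * α + d * (β * β)) / (α * α - d * (β * β)) * ((α * α + d * (β * β)) / (α * α - d * (β * β))) -
      d * (2 * α * β / (α * α - d * (β * β)) * (2 * α * β / (α * α - d * (β * β)))) = 1 := by
  have key : (α * α + d * (β * β)) * (α * α + d * (β * β)) - d * (2 * α * β * (2 * α * β)) =
      (α * α - d * (β * β)) * (α * α - d * (β * β)) := by ring
  rw [div_mul_div_comm, div_mul_div_comm, ← mul_div_assoc, div_sub_div_same, key, div_self (mul_ne_zero hN hN)]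

/-- **HILBERT 90, define-free** (`H¹(Gal(E∕K), E^×) = 0` for `E = K(√d)`): `2 ≠ 0`, `d ≠ 0`; if `a·a − d·(b·b) = 1` then `(a, b)` is the quotient `z∕σz` of some `z = (α, β)` with
`N z = α² − dβ² ≠ 0`, i.e. `a·N = α² + dβ²` and `b·N = 2αβ`: take `z = 1 + t = (1 + a, b)` (`N z = 2(1 + a) ≠ 0`) when `a ≠ −1`, and `z = √d = (0, 1)` when `a = −1` (then `b = 0`).
[cite: Serre1979, Ch. X §1] -/
theorem exists_quotient_of_norm_one (h2 : (2 : K) ≠ 0) {d : K} (hd0 : d ≠ 0) {a b : K} (h : a * a - d * (b * b) = 1) :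
    ∃ α β : K, α * α - d * (β * β) ≠ 0 ∧
      a * (α * α - d * (β * β)) = α * α + d * (β * β) ∧ b * (α * α - d * (β * β)) = 2 * α * β := by
  by_cases ha : 1 + a = 0
  · have ha' : a = -1 := by linear_combination ha
    have hb : b = 0 := by
      have hdb : d * (b * b) = 0 := by
        rw [ha'] at h
        linear_combination -h
      rcases mul_eq_zero.1 hdb with h' | h'
      · exact absurd h' hd0
      · exact mul_self_eq_zero.1 h'
    refine ⟨0, 1, ?_, ?_, ?_⟩
    · rw [mul_zero, mul_one, mul_one, zero_sub, neg_ne_zero]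
      exact hd0
    · rw [ha']
      ring
    · rw [hb]
      ring
  · refine ⟨1 + a, b, ?_, ?_, ?_⟩
    · have hN : (1 + a) * (1 + a) - d * (b * b) = 2 * (1 + a) := by linear_combination h
      rw [hN]
      exact mul_ne_zero h2 ha
    · linear_combination (1 + a) * h
    · linear_combination b * h

/-- **THE DEPTH OF A QUOTIENT**: for `N = α² − dβ² ≠ 0` and `(a, b) = ((α² + dβ²)∕N, 2αβ∕N)`: `(a − 1)·(a − 1) − d·(b·b) = −(4·d·β²)∕N` — define-free reading of
`|z∕σz − 1| = |σz − z|∕|z|` (★ p851075 `valued_div_galAdicCompletionMap_sub_one`; `σz − z = −2β√d`, `N(2β√d) = −4dβ²`). [cite: Serre1979, Ch. V §3] -/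
theorem depth_quotient_eq (d : K) {α β : K} (hN : α * α - d * (β * β) ≠ 0) :
    ((α * α + d * (β * β)) / (α * α - d * (β * β)) - 1) * ((α * α + d * (β * β)) / (α * α - d * (β * β)) - 1) -
      d * (2 * α * β / (α * α - d * (β * β)) * (2 * α * β / (α * α - d * (β * β)))) =
      -(4 * d * (β * β) / (α * α - d * (β * β))) := by
  have key : (α * α + d * (β * β) - (α * α - d * (β * β))) * (α * α + d * (β * β) - (α * α - d * (β * β))) - d * (2 * α * β * (2 * α * β)) =
      -(4 * d * (β * β)) * (α * α - d * (β * β)) := by ring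
  rw [div_sub_one hN, div_mul_div_comm, div_mul_div_comm, ← mul_div_assoc, div_sub_div_same, key, neg_mul, neg_div,
    mul_div_mul_right _ _ hN]

/-- **RESCALING INVARIANCE**: for `c ≠ 0` the pairs `(α, β)` and `(cα, cβ)` have the same quotient (`σ` fixes `K`: ★ p851075 `toPlace_mul_div_galAdicCompletionMap`).
[cite: Serre1979, Ch. X §1] -/
theorem quotient_mul_eq (d : K) {c : K} (hc : c ≠ 0) {α β : K} (hN : α * α - d * (β * β) ≠ 0) :
    (c * α * (c * α) + d * (c * β * (c * β))) / (c * α * (c * α) - d * (c * β * (c * β))) = (α * α + d * (β * β)) / (α * α - d * (β * β)) ∧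
      2 * (c * α) * (c * β) / (c * α * (c * α) - d * (c * β * (c * β))) = 2 * α * β / (α * α - d * (β * β)) := by
  have hcN : c * α * (c * α) - d * (c * β * (c * β)) ≠ 0 := by
    rw [show c * α * (c * α) - d * (c * β * (c * β)) = c * c * (α * α - d * (β * β)) by ring]
    exact mul_ne_zero (mul_ne_zero hc hc) hN
  constructor
  · rw [div_eq_div_iff hcN hN]
    ring
  · rw [div_eq_div_iff hcN hN]
    ring

end Algebra

section Valued
variable {K : Type*} [Field K] [Valued K ℤᵐ⁰]

/-! ## §2 No-tie: the valuation of a norm is a max -/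

/-- **NO-TIE, ODD ORDER**: if `v d` is not a square value then `v(α·α − d·(β·β)) = max (v α·v α) (v d·(v β·v β))` — the two terms have values of opposite parity.
[cite: Serre1979, Ch. V §3] [cite: Omeara1963, §63A 63:2–63:5] -/
theorem valued_sq_sub_mul_sq_eq_max_of_odd {d : K} (hdodd : ∀ y : K, Valued.v d ≠ Valued.v y * Valued.v y) (α β : K) :
    Valued.v (α * α - d * (β * β)) = max (Valued.v α * Valued.v α) (Valued.v d * (Valued.v β * Valued.v β)) := by
  by_cases hβ : β = 0
  · rw [hβ, mul_zero, mul_zero, sub_zero, map_zero, mul_zero, mul_zero, map_mul]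
    exact (max_eq_left zero_le).symm
  · have hvβ : Valued.v β ≠ 0 := (Valuation.ne_zero_iff _).2 hβ
    have hne : Valued.v (α * α) ≠ Valued.v (d * (β * β)) := by
      intro h
      refine hdodd (α / β) ?_
      rw [map_mul, map_mul, map_mul] at h
      rw [map_div₀, div_mul_div_comm, eq_div_iff (mul_ne_zero hvβ hvβ)]
      exact h.symm
    rw [sub_eq_add_neg, Valuation.map_add_of_distinct_val _ (by rwa [Valuation.map_neg]), Valuation.map_neg, map_mul, map_mul, map_mul]

/-- **NO-TIE, ODD DEFECT**: if `v 4 < v(d − 1)` and `v(d − 1)` is not a square value then, with `α² − dβ² = (α − β)(α + β) − (d − 1)β²`,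
`v(α·α − d·(β·β)) = max (v((α − β)·(α + β))) (v(d − 1)·(v β·v β))` AND the first argument is a square value or strictly below the second — by the trichotomy of `v(2β)`
against `v(α − β)` (smaller: `v(α + β) = v(α − β)`; equal: product `≤ v(2β)² = v 4·v β² < v(d − 1)·v β²`; larger: product `= v(α − β)·v(2β) < v(2β)²`).
[cite: Omeara1963, §63A 63:2–63:5] [cite: Serre1979, Ch. V §3] -/
theorem valued_sq_sub_mul_sq_eq_max_of_odd_defect {d : K} (h4d : Valued.v (4 : K) < Valued.v (d - 1))
    (hsodd : ∀ y : K, Valued.v (d - 1) ≠ Valued.v y * Valued.v y) (α β : K) :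
    Valued.v (α * α - d * (β * β)) = max (Valued.v ((α - β) * (α + β))) (Valued.v (d - 1) * (Valued.v β * Valued.v β)) ∧
      ((∃ y : K, Valued.v ((α - β) * (α + β)) = Valued.v y * Valued.v y) ∨
        Valued.v ((α - β) * (α + β)) < Valued.v (d - 1) * (Valued.v β * Valued.v β)) := by
  rw [show α * α - d * (β * β) = (α - β) * (α + β) - (d - 1) * (β * β) by ring]
  by_cases hβ : β = 0
  · refine ⟨?_, Or.inl ⟨α, by rw [hβ, sub_zero, add_zero, map_mul]⟩⟩
    rw [hβ, mul_zero, mul_zero, sub_zero, map_zero, mul_zero, mul_zero]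
    exact (max_eq_left zero_le).symm
  have hvβ : Valued.v β ≠ 0 := (Valuation.ne_zero_iff _).2 hβ
  have hvβpos : 0 < Valued.v β := zero_lt_iff.2 hvβ
  have hαβ : α + β = (α - β) + 2 * β := by ring
  have h4 : Valued.v (2 * β) * Valued.v (2 * β) = Valued.v (4 : K) * (Valued.v β * Valued.v β) := by
    rw [← map_mul, ← map_mul, ← map_mul]
    ring_nf
  -- the disjunction
  have hdisj : (∃ y : K, Valued.v ((α - β) * (α + β)) = Valued.v y * Valued.v y) ∨
      Valued.v ((α - β) * (α + β)) < Valued.v (d - 1) * (Valued.v β * Valued.v β) := by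
    rcases lt_trichotomy (Valued.v (2 * β)) (Valued.v (α - β)) with hlt | heq | hgt
    · refine Or.inl ⟨α - β, ?_⟩
      rw [map_mul, hαβ, Valuation.map_add_eq_of_lt_left _ hlt]
    · refine Or.inr ?_
      have hle : Valued.v (α + β) ≤ Valued.v (2 * β) := by
        rw [hαβ]
        refine (Valuation.map_add _ _ _).trans ?_
        rw [heq, max_self]
      rw [map_mul]
      calc Valued.v (α - β) * Valued.v (α + β) ≤ Valued.v (2 * β) * Valued.v (2 * β) := by
            rw [← heq]
            exact mul_le_mul_right hle _
        _ = Valued.v (4 : K) * (Valued.v β * Valued.v β) := h4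
        _ < Valued.v (d - 1) * (Valued.v β * Valued.v β) := mul_lt_mul_of_pos_right h4d (mul_pos hvβpos hvβpos)
    · refine Or.inr ?_
      have h2β : Valued.v (2 * β) ≠ 0 := ne_of_gt (lt_of_le_of_lt zero_le hgt)
      rw [map_mul, hαβ, Valuation.map_add_eq_of_lt_right _ hgt]
      calc Valued.v (α - β) * Valued.v (2 * β) < Valued.v (2 * β) * Valued.v (2 * β) := mul_lt_mul_of_pos_right hgt (zero_lt_iff.2 h2β)
        _ = Valued.v (4 : K) * (Valued.v β * Valued.v β) := h4
        _ < Valued.v (d - 1) * (Valued.v β * Valued.v β) := mul_lt_mul_of_pos_right h4d (mul_pos hvβpos hvβpos)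
  -- hence the two terms never tie
  have hsplit : Valued.v ((d - 1) * (β * β)) = Valued.v (d - 1) * (Valued.v β * Valued.v β) := by rw [map_mul, map_mul]
  have hne : Valued.v ((α - β) * (α + β)) ≠ Valued.v ((d - 1) * (β * β)) := by
    rw [hsplit]
    rcases hdisj with ⟨y, hy⟩ | hlt
    · intro htie
      refine hsodd (y / β) ?_
      rw [map_div₀, div_mul_div_comm, eq_div_iff (mul_ne_zero hvβ hvβ), ← hy]
      exact htie.symm
    · exact hlt.ne
  refine ⟨?_, hdisj⟩
  rw [sub_eq_add_neg, Valuation.map_add_of_distinct_val _ (by rwa [Valuation.map_neg]), Valuation.map_neg, hsplit]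

/-! ## §3 Read-offs on the two ramified normal forms -/

/-- **UNITS, ODD ORDER**: `v 2 = exp(−e)`, `v d ≤ 1` not a square value; if `v(α·α − d·(β·β)) = 1` (a define-free unit of `E = K(√d)`) then `v(4·d·(β·β)) ≤ exp(−(2e + 1))` —
the quotient `z∕σz` of a unit has depth `≥ f = 2e + 1`, i.e. `i_G(σ) = f` (`v d·v β² ≤ 1` by no-tie and `≠ 1` by parity, hence `≤ exp(−1)` by discreteness).
[cite: Serre1979, Ch. V §3; Ch. IV §1] -/
theorem valued_four_mul_mul_sq_le_of_unit_odd {e : ℕ} (he : Valued.v (2 : K) = exp (-(e : ℤ))) {d : K}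
    (hdodd : ∀ y : K, Valued.v d ≠ Valued.v y * Valued.v y) {α β : K} (hu : Valued.v (α * α - d * (β * β)) = 1) :
    Valued.v (4 * d * (β * β)) ≤ exp (-(2 * (e : ℤ) + 1)) := by
  by_cases hβ : β = 0
  · rw [hβ, mul_zero, mul_zero, map_zero]
    exact zero_le
  have hvβ : Valued.v β ≠ 0 := (Valuation.ne_zero_iff _).2 hβ
  have hle : Valued.v d * (Valued.v β * Valued.v β) ≤ 1 := by
    rw [← hu, valued_sq_sub_mul_sq_eq_max_of_odd hdodd α β]
    exact le_max_right _ _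
  have hne : Valued.v d * (Valued.v β * Valued.v β) ≠ 1 := by
    intro h1
    refine hdodd β⁻¹ ?_
    rw [map_inv₀, ← mul_inv]
    exact eq_inv_of_mul_eq_one_left h1
  have hlt : Valued.v d * (Valued.v β * Valued.v β) ≤ exp (-(0 + 1 : ℤ)) :=
    le_exp_neg_add_one_of_lt_exp_neg (by rw [neg_zero, exp_zero]; exact lt_of_le_of_ne hle hne)
  have h4 : Valued.v (4 : K) = exp (-(2 * (e : ℤ))) := by
    rw [show (4 : K) = 2 * 2 by norm_num, map_mul, he, ← exp_add]
    congr 1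
    ring
  rw [show 4 * d * (β * β) = 4 * (d * (β * β)) by ring, map_mul, map_mul, map_mul, h4]
  calc exp (-(2 * (e : ℤ))) * (Valued.v d * (Valued.v β * Valued.v β)) ≤ exp (-(2 * (e : ℤ))) * exp (-(0 + 1 : ℤ)) := mul_le_mul_right hlt _
    _ = exp (-(2 * (e : ℤ) + 1)) := by rw [← exp_add]; congr 1; ring

/-- **ODD VALUES, ODD ORDER**: `v 2 = exp(−e)`, `v d` not a square value; if `v(α·α − d·(β·β)) = exp(−(2m + 1))` — an ODD value, e.g. a define-free UNIFORMISER of `E` (`m = 0`)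
— then `v(4·d·(β·β)) = exp(−(2e + 2m + 1))` EXACTLY (the square value `v α²` cannot be the max).  For `m = 0`: the uniformiser quotient has depth `exp(−2e) = exp(−(f − 1))`.
[cite: Serre1979, Ch. V §3; Ch. IV §1] -/
theorem valued_four_mul_mul_sq_eq_of_odd_value_odd {e : ℕ} (he : Valued.v (2 : K) = exp (-(e : ℤ))) {d : K}
    (hdodd : ∀ y : K, Valued.v d ≠ Valued.v y * Valued.v y) {α β : K} {m : ℤ} (hN : Valued.v (α * α - d * (β * β)) = exp (-(2 * m + 1))) :
    Valued.v (4 * d * (β * β)) = exp (-(2 * (e : ℤ) + 2 * m + 1)) := by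
  have hmax := valued_sq_sub_mul_sq_eq_max_of_odd hdodd α β
  have hnsq : Valued.v (α * α - d * (β * β)) ≠ Valued.v α * Valued.v α :=
    valued_ne_mul_self_of_eq_exp_odd (n := -m - 1) (by rw [hN]; congr 1; ring) α
  have hsnd : Valued.v d * (Valued.v β * Valued.v β) = exp (-(2 * m + 1)) := by
    rw [← hN]
    rcases max_choice (Valued.v α * Valued.v α) (Valued.v d * (Valued.v β * Valued.v β)) with h | h
    · exact absurd (hmax.trans h) hnsq
    · exact (hmax.trans h).symm
  have h4 : Valued.v (4 : K) = exp (-(2 * (e : ℤ))) := by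
    rw [show (4 : K) = 2 * 2 by norm_num, map_mul, he, ← exp_add]
    congr 1
    ring
  rw [show 4 * d * (β * β) = 4 * (d * (β * β)) by ring, map_mul, map_mul, map_mul, h4, hsnd, ← exp_add]
  congr 1
  ring

/-- **PARITY, ODD ORDER (no odd steps)**: if `v d` is not a square value then `v(4·d·(β·β))` is never a square value for `β ≠ 0` — the quotient depths of units all have
the parity of `f = 2e + 1`, so `T^{(f + 2j − 1)} = T^{(f + 2j)}` on the unit quotients. [cite: Serre1979, Ch. V §3] [cite: Flicker1998UnitaryFL, Prop. 7 p. 84] -/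
theorem valued_four_mul_mul_sq_ne_sq_of_odd (h2 : (2 : K) ≠ 0) {d : K} (hdodd : ∀ y : K, Valued.v d ≠ Valued.v y * Valued.v y)
    {β : K} (hβ : β ≠ 0) (y : K) : Valued.v (4 * d * (β * β)) ≠ Valued.v y * Valued.v y := by
  intro h
  have hv2β : Valued.v (2 * β) ≠ 0 := (Valuation.ne_zero_iff _).2 (mul_ne_zero h2 hβ)
  refine hdodd (y / (2 * β)) ?_
  rw [show 4 * d * (β * β) = d * (2 * β * (2 * β)) by ring, map_mul, map_mul] at h
  rw [map_div₀, div_mul_div_comm, eq_div_iff (mul_ne_zero hv2β hv2β)]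
  exact h

/-- **PARITY, ODD DEFECT (no odd steps)**: if `v(d − 1) < 1` (so `v d = 1`) then `v(4·d·(β·β)) = v(2β)·v(2β)` IS a square value — the quotient depths of units all have the
parity of `f = 2e + 1 − s` (even), so `T^{(f + 2j − 1)} = T^{(f + 2j)}` on the unit quotients. [cite: Serre1979, Ch. V §3] [cite: Flicker1998UnitaryFL, Prop. 7 p. 84] -/
theorem valued_four_mul_mul_sq_eq_sq_of_odd_defect {d : K} (hd1 : Valued.v (d - 1) < 1) (β : K) :
    Valued.v (4 * d * (β * β)) = Valued.v (2 * β) * Valued.v (2 * β) := by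
  have hvd : Valued.v d = 1 := by
    rw [show d = 1 + (d - 1) by ring]
    exact Valuation.map_one_add_of_lt _ hd1
  rw [show 4 * d * (β * β) = d * (2 * β * (2 * β)) by ring, map_mul, map_mul, hvd, one_mul]

/-- **UNITS, ODD DEFECT**: `v 2 = exp(−e)`, `v(d − 1) = exp(−s)` with `v 4 < v(d − 1) < 1` not a square value; if `v(α·α − d·(β·β)) = 1` then `v(4·d·(β·β)) ≤ exp(−(2e + 1 − s))`
— the quotient of a define-free unit has depth `≥ f = 2e + 1 − s` (`v(d − 1)·v β² ≤ 1`, `≠ 1` by parity, so `v β² ≤ exp(s − 1)`; `v d = 1`).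
[cite: Serre1979, Ch. V §3; Ch. IV §1] [cite: Omeara1963, §63A 63:5] -/
theorem valued_four_mul_mul_sq_le_of_unit_odd_defect {e : ℕ} (he : Valued.v (2 : K) = exp (-(e : ℤ))) {d : K} {s : ℕ}
    (hs : Valued.v (d - 1) = exp (-(s : ℤ))) (h4d : Valued.v (4 : K) < Valued.v (d - 1)) (hd1 : Valued.v (d - 1) < 1)
    (hsodd : ∀ y : K, Valued.v (d - 1) ≠ Valued.v y * Valued.v y) {α β : K} (hu : Valued.v (α * α - d * (β * β)) = 1) :
    Valued.v (4 * d * (β * β)) ≤ exp (-(2 * (e : ℤ) + 1 - s)) := by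
  by_cases hβ : β = 0
  · rw [hβ, mul_zero, mul_zero, map_zero]
    exact zero_le
  have hvβ : Valued.v β ≠ 0 := (Valuation.ne_zero_iff _).2 hβ
  have hvd : Valued.v d = 1 := by
    rw [show d = 1 + (d - 1) by ring]
    exact Valuation.map_one_add_of_lt _ hd1
  have hle : Valued.v (d - 1) * (Valued.v β * Valued.v β) ≤ 1 := by
    rw [← hu, (valued_sq_sub_mul_sq_eq_max_of_odd_defect h4d hsodd α β).1]
    exact le_max_right _ _
  have hne : Valued.v (d - 1) * (Valued.v β * Valued.v β) ≠ 1 := by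
    intro h1
    refine hsodd β⁻¹ ?_
    rw [map_inv₀, ← mul_inv]
    exact eq_inv_of_mul_eq_one_left h1
  have hlt : Valued.v (d - 1) * (Valued.v β * Valued.v β) ≤ exp (-(0 + 1 : ℤ)) :=
    le_exp_neg_add_one_of_lt_exp_neg (by rw [neg_zero, exp_zero]; exact lt_of_le_of_ne hle hne)
  rw [hs] at hlt
  have h4 : Valued.v (4 : K) = exp (-(2 * (e : ℤ))) := by
    rw [show (4 : K) = 2 * 2 by norm_num, map_mul, he, ← exp_add]
    congr 1
    ring
  rw [show 4 * d * (β * β) = 4 * (d * (β * β)) by ring, map_mul, map_mul, map_mul, h4, hvd, one_mul]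
  calc exp (-(2 * (e : ℤ))) * (Valued.v β * Valued.v β)
        = exp (-(2 * (e : ℤ)) + s) * (exp (-(s : ℤ)) * (Valued.v β * Valued.v β)) := by
          rw [← mul_assoc (exp (-(2 * (e : ℤ)) + s)), ← exp_add]
          congr 2
          ring
    _ ≤ exp (-(2 * (e : ℤ)) + s) * exp (-(0 + 1 : ℤ)) := mul_le_mul_right hlt _
    _ = exp (-(2 * (e : ℤ) + 1 - s)) := by rw [← exp_add]; congr 1; ring

/-- **ODD VALUES, ODD DEFECT**: with `v 2 = exp(−e)`, `v(d − 1) = exp(−s)`, `v 4 < v(d − 1) < 1` not a square value: if `v(α·α − d·(β·β)) = exp(−(2m + 1))` (odd value; a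
uniformiser for `m = 0`) then `v(4·d·(β·β)) = exp(−(2e + 2m + 1) + s)` EXACTLY — for an odd max the first no-tie term (square-valued or strictly smaller) cannot be the
max, so `v(d − 1)·v β² = exp(−(2m + 1))`.  For `m = 0`: the uniformiser quotient has depth `exp(−(2e − s)) = exp(−(f − 1))`.
[cite: Serre1979, Ch. V §3; Ch. IV §1] [cite: Omeara1963, §63A 63:5] -/
theorem valued_four_mul_mul_sq_eq_of_odd_value_odd_defect {e : ℕ} (he : Valued.v (2 : K) = exp (-(e : ℤ))) {d : K} {s : ℕ}
    (hs : Valued.v (d - 1) = exp (-(s : ℤ))) (h4d : Valued.v (4 : K) < Valued.v (d - 1)) (hd1 : Valued.v (d - 1) < 1)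
    (hsodd : ∀ y : K, Valued.v (d - 1) ≠ Valued.v y * Valued.v y) {α β : K} {m : ℤ}
    (hN : Valued.v (α * α - d * (β * β)) = exp (-(2 * m + 1))) :
    Valued.v (4 * d * (β * β)) = exp (-(2 * (e : ℤ) + 2 * m + 1) + s) := by
  obtain ⟨hmax, hdisj⟩ := valued_sq_sub_mul_sq_eq_max_of_odd_defect h4d hsodd α β
  have hvd : Valued.v d = 1 := by
    rw [show d = 1 + (d - 1) by ring]
    exact Valuation.map_one_add_of_lt _ hd1
  have hodd : ∀ y : K, Valued.v (α * α - d * (β * β)) ≠ Valued.v y * Valued.v y :=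
    valued_ne_mul_self_of_eq_exp_odd (n := -m - 1) (by rw [hN]; congr 1; ring)
  -- the first term is not the max
  have hsnd : Valued.v (d - 1) * (Valued.v β * Valued.v β) = exp (-(2 * m + 1)) := by
    rw [← hN]
    rcases max_choice (Valued.v ((α - β) * (α + β))) (Valued.v (d - 1) * (Valued.v β * Valued.v β)) with h | h
    · exfalso
      have hfst : Valued.v (α * α - d * (β * β)) = Valued.v ((α - β) * (α + β)) := hmax.trans h
      rcases hdisj with ⟨y, hy⟩ | hlt
      · exact hodd y (hfst.trans hy)
      · rw [← hfst, hmax] at hlt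
        exact absurd hlt (not_lt.2 (le_max_right _ _))
    · exact (hmax.trans h).symm
  have h4 : Valued.v (4 : K) = exp (-(2 * (e : ℤ))) := by
    rw [show (4 : K) = 2 * 2 by norm_num, map_mul, he, ← exp_add]
    congr 1
    ring
  have hββ : Valued.v β * Valued.v β = exp (-(2 * m + 1) + s) := by
    rw [hs] at hsnd
    calc Valued.v β * Valued.v β = exp (s : ℤ) * (exp (-(s : ℤ)) * (Valued.v β * Valued.v β)) := by
          rw [← mul_assoc, ← exp_add, add_neg_cancel, exp_zero, one_mul]
      _ = exp (-(2 * m + 1) + s) := by rw [hsnd, ← exp_add]; congr 1; ring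
  rw [show 4 * d * (β * β) = 4 * (d * (β * β)) by ring, map_mul, map_mul, map_mul, h4, hvd, one_mul, hββ, ← exp_add]
  congr 1
  ring

/-- **DEFINE-FREE UNIFORMISERS EXIST, ODD ORDER**: if `v d = exp(−(2r + 1))` and `v ϖ = exp(−1)` then `(0, ϖ^{−r})` has `v(α² − dβ²) = exp(−1)` (`√d·ϖ^{−r}` is a uniformiser
of `E`). [cite: Serre1979, Ch. I §6] -/
theorem exists_uniformizer_pair_odd {ϖ : K} (hϖ : Valued.v ϖ = exp (-1 : ℤ)) {d : K} {r : ℤ} (hdr : Valued.v d = exp (-(2 * r + 1))) :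
    ∃ α β : K, Valued.v (α * α - d * (β * β)) = exp (-1 : ℤ) := by
  refine ⟨0, ϖ ^ (-r), ?_⟩
  rw [mul_zero, zero_sub, Valuation.map_neg, map_mul, map_mul, valued_uniformizer_zpow hϖ, hdr, ← exp_add, ← exp_add]
  congr 1
  ring

/-- **DEFINE-FREE UNIFORMISERS EXIST, ODD DEFECT**: if `v(d − 1) = exp(−(2k + 1))` and `v ϖ = exp(−1)` then `(−ϖ^{−k}, ϖ^{−k})` has `v(α² − dβ²) = exp(−1)`
(`(√d − 1)·ϖ^{−k}` is a uniformiser of `E`: `N(√d − 1) = 1 − d`). [cite: Omeara1963, §63A 63:5] [cite: Serre1979, Ch. I §6] -/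
theorem exists_uniformizer_pair_odd_defect {ϖ : K} (hϖ : Valued.v ϖ = exp (-1 : ℤ)) {d : K} {k : ℕ}
    (hs : Valued.v (d - 1) = exp (-(2 * (k : ℤ) + 1))) :
    ∃ α β : K, Valued.v (α * α - d * (β * β)) = exp (-1 : ℤ) := by
  refine ⟨-(ϖ ^ (-(k : ℤ))), ϖ ^ (-(k : ℤ)), ?_⟩
  rw [show -(ϖ ^ (-(k : ℤ))) * -(ϖ ^ (-(k : ℤ))) - d * (ϖ ^ (-(k : ℤ)) * ϖ ^ (-(k : ℤ))) = -((d - 1) * (ϖ ^ (-(k : ℤ)) * ϖ ^ (-(k : ℤ)))) by ring,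
    Valuation.map_neg, map_mul, map_mul, hs, valued_uniformizer_zpow hϖ, ← exp_add, ← exp_add]
  congr 1
  ring

end Valued

end Literature.NumberTheory.LocalFields
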